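import Literature.NumberTheory.PAdicHodge.TateAlmostEtaleKummerStep
import Literature.NumberTheory.PAdicHodge.TateAlmostEtaleTwistedBasis
import HarnessLib

/-!
# Propagation of the almost-perfectoid package along a Kummer `p`-step
# (toward Tate's almost étale lemma, Tate 1967 §3.2 Prop. 9 / Berger–Colmez (TS1))

Notation as in `TateAlmostEtaleIntegralBases` / `TateAlmostEtaleTwistedBasis` (`K₀ ⊆ M ⊆ F̄`,
`q = ‖p‖`, package `pkg_s(M)` = (Γ) + (U_s)). For `a ∈ M` with `X^p - a` irreducible over `M` and a
root `α ∈ F̄`, the package PROPAGATES from `M` to `M(α)`: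

* `TateAlmostEtale.adjoin_exists_norm_pow_eq` : (Γ′) the value group of `M(α)` is that of `M`
  (`‖N(z)‖ = ‖z‖^p` by isometric conjugates), hence `p`-divisible;
* `TateAlmostEtale.adjoin_exists_norm_sub_pow_le` : **(U′) every integer of `M(α)` is a `p`-th power
  modulo `q^{s'}` for every `0 < s' < min s 1`.** Proof: renormalise the Kummer generator to depth
  `D = p/(p-1) - e₀` (`KummerDepth`), `α' = α b = 1 + β`, `c ∈ M` with `‖c‖ = ‖β‖`, `γ = β/c`; the
  conjugates `g • γ = (ζ α' - 1)/c` (`ζ ≠ 1` a `p`-th root of unity) satisfy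
  `‖γ - g • γ‖ = q^{1/(p-1)}/‖β‖ ≥ q^{e₀/p}` and, as `e₀ < 1`, `‖γ^p - g • γ^p‖ = ‖γ - g • γ‖^p ≥ q^{e₀}`
  (`norm_sub_smul_twisted_ge`); so `θ = γ^p ∉ M` generates `M(α)`, its power basis consists of `p`-th
  powers, and its different has norm `≥ q^{(p-1) e₀} = q^{min s 1 - s'}`
  (Mathlib `Splits.eval_root_derivative`); conclude by `exists_norm_sub_pow_le_of_twisted_powerBasis`.

So `pkg_s(M) ⇒ pkg_{s'}(M(α))` for all `s' < min s 1` — the induction step of the Sylow dévissage of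
Tate's almost étale lemma along Galois `p`-towers over `K_∞` (package of `K_∞`: `CyclotomicTowerPthPowers`;
Kummer step of the trace: `TateAlmostEtaleKummerStep`). Own elementary route to Tate 1967 §3.2 Prop. 9 =
Berger–Colmez 2008 Prop. 4.1.1. No `sorry`, no definitions.
References: [Tate1967] §3.2 Prop. 9; [BergerColmez2008] Déf. 3.1.3, Prop. 4.1.1.
-/

noncomputable section

open Polynomial IntermediateField Module ValuativeRel Field

namespace Literature.NumberTheory.PAdicHodge

namespace TateAlmostEtale

open Literature.NumberTheory.GaloisRepresentations
open Literature.NumberTheory.GaloisRepresentations.IsNonarchimedeanLocalField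

variable {F : Type} [Field F] [ValuativeRel F] [TopologicalSpace F] [IsNonarchimedeanLocalField F]
  [CharZero F] {p : ℕ} [Fact p.Prime] (hp : valuation F p < 1)
/-! ### The Kummer step: `pkg_s(M) ⇒ pkg_{s'}(M(α))` -/

section KummerStep

variable (M : IntermediateField (PadicBase F p hp) (NormedAlgClosure F))

variable {s : ℝ} (hs : 0 < s)
  (hΓ : ∀ x ∈ M, x ≠ 0 → ∃ c ∈ M, ‖c‖ ^ p = ‖x‖)
  (hU : ∀ u ∈ M, ‖u‖ ≤ 1 → ∃ w ∈ M, ‖u - w ^ p‖ ≤ ‖(p : NormedAlgClosure F)‖ ^ s)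
  {a : M} (hirr : Irreducible (X ^ p - C a)) {α : NormedAlgClosure F}
  (hα : α ^ p = (a : NormedAlgClosure F))

include hirr hα in
/-- `[M(α) : M] = p`. [folklore] -/
private theorem finrank_adjoin_eq : finrank M (↥M)⟮α⟯ = p := by
  have hprime : p.Prime := Fact.out
  have hint : IsIntegral M α := ⟨X ^ p - C a, monic_X_pow_sub_C a hprime.ne_zero, by simp [hα]⟩
  have hminpoly : minpoly M α = X ^ p - C a :=
    (minpoly.eq_of_irreducible_of_monic hirr (by simp [hα]) (monic_X_pow_sub_C a hprime.ne_zero)).symm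
  rw [adjoin.finrank hint, hminpoly, natDegree_X_pow_sub_C]

include hα in
/-- `M(α)/M` is finite-dimensional. [folklore] -/
private theorem finiteDimensional_adjoin : FiniteDimensional M (↥M)⟮α⟯ := by
  have hprime : p.Prime := Fact.out
  exact adjoin.finiteDimensional ⟨X ^ p - C a, monic_X_pow_sub_C a hprime.ne_zero, by simp [hα]⟩

include hΓ hirr hα in
/-- Elements of `M(α)` have norms in `‖M^×‖`: for `x ∈ M(α)`, `x ≠ 0`, some `c ∈ M^×` has `‖c‖ = ‖x‖`
(`‖N(x)‖ = ‖x‖^p` and (Γ) for `M`). [cite: Tate1967, §3.2 Prop. 9] [cite: BergerColmez2008, Prop. 4.1.1] -/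
theorem adjoin_exists_norm_eq {x : NormedAlgClosure F} (hx : x ∈ (↥M)⟮α⟯) (hx0 : x ≠ 0) :
    ∃ c ∈ M, c ≠ 0 ∧ ‖c‖ = ‖x‖ := by
  have hprime : p.Prime := Fact.out
  haveI := finiteDimensional_adjoin hp M hα
  set z : (↥M)⟮α⟯ := ⟨x, hx⟩ with hz
  have hz0 : z ≠ 0 := fun h => hx0 (by rw [hz] at h; exact congrArg Subtype.val h)
  haveI : Module.Free M (↥M)⟮α⟯ := Module.Free.of_divisionRing M _
  set N : M := Algebra.norm M z with hN
  have hN0 : N ≠ 0 := Algebra.norm_ne_zero_iff.mpr hz0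
  have hNE : (N : NormedAlgClosure F) ≠ 0 := fun h => hN0 (by exact_mod_cast h)
  have hNn : ‖(N : NormedAlgClosure F)‖ = ‖x‖ ^ p := by
    rw [hN, norm_norm_eq hp M (↥M)⟮α⟯ z, finrank_adjoin_eq hp M hirr hα]
  obtain ⟨c, hcM, hc⟩ := hΓ N N.2 hNE
  rw [hNn] at hc
  have hcx : ‖c‖ = ‖x‖ := (pow_left_inj₀ (norm_nonneg _) (norm_nonneg _) hprime.ne_zero).mp hc
  refine ⟨c, hcM, ?_, hcx⟩
  intro h; rw [h, norm_zero] at hcx; exact hx0 (norm_eq_zero.mp hcx.symm)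

include hΓ hirr hα in
/-- **(Γ′) The value group of `M(α)` is `p`-divisible** (indeed equal to that of `M`): for
`x ∈ M(α)^×` some `c ∈ M ⊆ M(α)` has `‖c‖^p = ‖x‖`. First half of `pkg(M) ⇒ pkg(M(α))`.
[cite: Tate1967, §3.2 Prop. 9] [cite: BergerColmez2008, Prop. 4.1.1] -/
theorem adjoin_exists_norm_pow_eq {x : NormedAlgClosure F} (hx : x ∈ (↥M)⟮α⟯) (hx0 : x ≠ 0) :
    ∃ c ∈ (↥M)⟮α⟯, ‖c‖ ^ p = ‖x‖ := by
  obtain ⟨c, hcM, hc0, hcx⟩ := adjoin_exists_norm_eq hp M hΓ hirr hα hx hx0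
  obtain ⟨c₂, hc₂M, hc₂⟩ := hΓ c hcM hc0
  exact ⟨c₂, IntermediateField.algebraMap_mem (↥M)⟮α⟯ ⟨c₂, hc₂M⟩, by rw [hc₂, hcx]⟩

/-- In an extension `L/M` of prime degree `p`, an element `θ ∈ L ∖ M` generates: `M(θ) = L`
(tower law). [folklore] -/
private theorem adjoin_eq_top_of_not_mem {L : IntermediateField M (NormedAlgClosure F)}
    [FiniteDimensional M L] (hfin : finrank M L = p) (θL : L)
    (hθM : (θL : NormedAlgClosure F) ∉ Set.range (algebraMap M (NormedAlgClosure F))) :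
    (↥M)⟮θL⟯ = ⊤ := by
  have hprime : p.Prime := Fact.out
  have hθLint : IsIntegral M θL := .of_finite M θL
  haveI : Module.Free M (↥M)⟮θL⟯ := Module.Free.of_divisionRing _ _
  haveI : Module.Free (↥M)⟮θL⟯ L := Module.Free.of_divisionRing _ _
  have hnat : (minpoly M θL).natDegree = p := by
    have hdvd : (minpoly M θL).natDegree ∣ p := by
      have h := Module.finrank_mul_finrank M (↥M)⟮θL⟯ L
      rw [adjoin.finrank hθLint, hfin] at h
      exact Dvd.intro _ h
    rcases (Nat.dvd_prime hprime).mp hdvd with h1 | hp'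
    · exfalso
      apply hθM
      obtain ⟨m, hm⟩ := minpoly.natDegree_eq_one_iff.mp h1
      exact ⟨m, by rw [← hm]; rfl⟩
    · exact hp'
  apply IntermediateField.eq_of_le_of_finrank_eq le_top
  rw [adjoin.finrank hθLint, hnat, finrank_top', hfin]

include hp in
/-- **Conjugates of the twisted generator are far apart.** With `α'^p = a' ∈ M`, `‖α'‖ = 1`,
`β = α' - 1 ≠ 0`, `c ∈ M` with `‖c‖ = ‖β‖ ≤ ‖p‖^{D/p}`, `γ = β/c`, `θ = γ^p`, and exponents with
`‖p‖^{e₀/p} ‖p‖^{D/p} = ‖p‖^{1/(p-1)}`, `e₀ < 1`: for every `g ∈ G₀` fixing `M` with `g • α' ≠ α'` one has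
`‖θ - g • θ‖ ≥ ‖p‖^{e₀}` (so `g • θ ≠ θ`): `g • α' = ζ α'` with `ζ ≠ 1` a `p`-th root of unity,
`γ - g • γ = α'(1 - ζ)/c` has norm `‖p‖^{1/(p-1)}/‖β‖ ≥ ‖p‖^{e₀/p} > ‖p‖^{1/p}`, and `‖x^p - y^p‖ = ‖x - y‖^p`.
[cite: Tate1967, §3.2 Prop. 9] [cite: BergerColmez2008, Prop. 4.1.1] -/
theorem norm_sub_smul_twisted_ge {α' c a'E : NormedAlgClosure F} (ha'M : a'E ∈ M) (hcM : c ∈ M)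
    (hα'p : α' ^ p = a'E) (hα'n : ‖α'‖ = 1) (hβ0 : α' - 1 ≠ 0) (hcβ : ‖c‖ = ‖α' - 1‖)
    {D e₀ : ℝ} (hβD : ‖α' - 1‖ ≤ ‖(p : NormedAlgClosure F)‖ ^ (D / p)) (he₀1 : e₀ < 1)
    (hexp : ‖(p : NormedAlgClosure F)‖ ^ (e₀ / p) * ‖(p : NormedAlgClosure F)‖ ^ (D / p) =
      ‖(p : NormedAlgClosure F)‖ ^ (1 / ((p : ℝ) - 1)))
    (g : BaseGaloisGroup hp) (hgM : ∀ y ∈ M, g • y = y) (hgα' : g • α' ≠ α') :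
    ‖(p : NormedAlgClosure F)‖ ^ e₀ ≤ ‖((α' - 1) / c) ^ p - g • ((α' - 1) / c) ^ p‖ ∧
      g • ((α' - 1) / c) ^ p ≠ ((α' - 1) / c) ^ p := by
  have hprime : p.Prime := Fact.out
  set q : ℝ := ‖(p : NormedAlgClosure F)‖ with hq
  have hp0 : (p : NormedAlgClosure F) ≠ 0 := Nat.cast_ne_zero.mpr hprime.ne_zero
  have hq0 : 0 < q := norm_pos_iff.mpr hp0
  have hq1 : q < 1 := by rw [hq, PadicBase.norm_natCast_closure hp]; exact PadicBase.norm_p_lt_one hp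
  have hp0r : (0 : ℝ) < p := by exact_mod_cast hprime.pos
  have hα'0 : α' ≠ 0 := norm_pos_iff.mp (by rw [hα'n]; exact one_pos)
  have hc0 : c ≠ 0 := by
    intro h; rw [h, norm_zero] at hcβ; exact hβ0 (norm_eq_zero.mp hcβ.symm)
  set β : NormedAlgClosure F := α' - 1 with hβ
  set γ : NormedAlgClosure F := β / c with hγ
  have hγn : ‖γ‖ = 1 := by rw [hγ, norm_div, hcβ, div_self (norm_ne_zero_iff.mpr hβ0)]
  -- `g • α' = ζ α'` with `ζ^p = 1`, `ζ ≠ 1`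
  have hgc : g c = c := hgM c hcM
  have hga' : g a'E = a'E := hgM _ ha'M
  set ζ : NormedAlgClosure F := g • α' / α' with hζ
  have hζp : ζ ^ p = 1 := by
    rw [hζ, div_pow, BaseGaloisGroup.smul_def, ← map_pow, hα'p, hga', div_self]
    rw [← hα'p]; exact pow_ne_zero _ hα'0
  have hgα'eq : g • α' = ζ * α' := by rw [hζ, div_mul_cancel₀ _ hα'0]
  have hζ1 : ζ ≠ 1 := by
    intro h; apply hgα'; rw [hgα'eq, h, one_mul]
  have hζn : ‖ζ - 1‖ = q ^ (1 / ((p : ℝ) - 1)) := norm_sub_one_of_pow_prime_eq_one hp hζp hζ1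
  -- `γ - g • γ = α' (1 - ζ) / c`
  have hgγ : g • γ = (ζ * α' - 1) / c := by
    rw [← hgα'eq, hγ, hβ, BaseGaloisGroup.smul_def, BaseGaloisGroup.smul_def, map_div₀, map_sub,
      map_one, hgc]
  have hdiff : ‖γ - g • γ‖ = q ^ (1 / ((p : ℝ) - 1)) / ‖β‖ := by
    have : γ - g • γ = α' * (1 - ζ) / c := by rw [hgγ, hγ, hβ]; field_simp; ring
    rw [this, norm_div, norm_mul, hα'n, one_mul, norm_sub_rev, hζn, hcβ]
  have hdiff_ge : q ^ (e₀ / p) ≤ ‖γ - g • γ‖ := by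
    rw [hdiff, le_div_iff₀ (norm_pos_iff.mpr hβ0), ← hexp]
    gcongr
  have hgγn : ‖g • γ‖ ≤ 1 := by rw [BaseGaloisGroup.norm_smul, hγn]
  have hpow : q ^ e₀ ≤ ‖γ - g • γ‖ ^ p := by
    calc q ^ e₀ = (q ^ (e₀ / p)) ^ p := by
          rw [← Real.rpow_natCast, ← Real.rpow_mul hq0.le, div_mul_cancel₀ _ hp0r.ne']
      _ ≤ ‖γ - g • γ‖ ^ p := pow_le_pow_left₀ (Real.rpow_nonneg hq0.le _) hdiff_ge p
  have hpow_gt : q < ‖γ - g • γ‖ ^ p := by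
    have h0 : q < q ^ e₀ := by
      conv_lhs => rw [← Real.rpow_one q]
      exact Real.rpow_lt_rpow_of_exponent_gt hq0 hq1 he₀1
    exact h0.trans_le hpow
  have hθdiff : ‖γ ^ p - g • γ ^ p‖ = ‖γ - g • γ‖ ^ p := by
    rw [BaseGaloisGroup.smul_def, map_pow, ← BaseGaloisGroup.smul_def]
    exact norm_pow_sub_pow_eq hprime hγn.le hgγn hpow_gt
  refine ⟨by rw [hθdiff]; exact hpow, fun h => ?_⟩
  have : ‖γ ^ p - g • γ ^ p‖ = 0 := by rw [h, sub_self, norm_zero]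
  rw [hθdiff] at this
  have h0 := (pow_eq_zero_iff hprime.ne_zero).mp this
  rw [h0, zero_pow hprime.ne_zero] at hpow_gt
  exact absurd hpow_gt (not_lt.mpr hq0.le)

include hs hΓ hU hirr hα in
/-- **(U′) Every integer of `M(α)` is a `p`-th power modulo `p^{s'}`, for any `0 < s' < min s 1`.**
Second half of `pkg_s(M) ⇒ pkg_{s'}(M(α))`: with a deep renormalisation `a b^p = 1 + t` (`KummerDepth`),
`γ = (α b - 1)/c`, the power basis `θ^i = (γ^i)^p` of `M(α)` consists of `p`-th powers and is almost
self-dual (`‖f'(θ)‖ ≥ ‖p‖^{min s 1 - s'}`), so `exists_norm_sub_pow_le_of_twisted_powerBasis` applies.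
[cite: Tate1967, §3.2 Prop. 9] [cite: BergerColmez2008, Prop. 4.1.1] -/
theorem adjoin_exists_norm_sub_pow_le {s' : ℝ} (hs' : 0 < s') (hs's : s' < min s 1)
    {u : NormedAlgClosure F} (hu : u ∈ (↥M)⟮α⟯) (hu1 : ‖u‖ ≤ 1) :
    ∃ w ∈ (↥M)⟮α⟯, ‖u - w ^ p‖ ≤ ‖(p : NormedAlgClosure F)‖ ^ s' := by
  have hprime : p.Prime := Fact.out
  set q : ℝ := ‖(p : NormedAlgClosure F)‖ with hq
  have hp0 : (p : NormedAlgClosure F) ≠ 0 := Nat.cast_ne_zero.mpr hprime.ne_zero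
  have hq0 : 0 < q := norm_pos_iff.mpr hp0
  have hq1 : q < 1 := by rw [hq, PadicBase.norm_natCast_closure hp]; exact PadicBase.norm_p_lt_one hp
  have hpr : (1 : ℝ) < p := by exact_mod_cast hprime.one_lt
  have hp0r : (0 : ℝ) < p := by linarith
  have hp2 : (2 : ℝ) ≤ p := by exact_mod_cast hprime.two_le
  have hp1ne : (p : ℝ) - 1 ≠ 0 := by linarith
  have hpne : (p : ℝ) ≠ 0 := by linarith
  set L := (↥M)⟮α⟯ with hLdef
  haveI : FiniteDimensional M L := finiteDimensional_adjoin hp M hα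
  have hfin : finrank M L = p := finrank_adjoin_eq hp M hirr hα
  -- exponents: `δ = min s 1 - s'`, `e₀ = δ/(p-1)`, depth `D = p/(p-1) - e₀`
  set δ : ℝ := min s 1 - s' with hδ
  have hδ0 : 0 < δ := by rw [hδ]; linarith
  have hδ1 : δ < 1 := by rw [hδ]; linarith [min_le_right s 1]
  set Lr : ℝ := (p : ℝ) / (p - 1) with hLr
  set e₀ : ℝ := δ / (p - 1) with he₀
  have he₀0 : 0 < e₀ := div_pos hδ0 (by linarith)
  have he₀1 : e₀ < 1 := by rw [he₀, div_lt_one (by linarith)]; linarith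
  set D : ℝ := Lr - e₀ with hD
  have hDL : D < Lr := by rw [hD]; linarith
  have hLr1 : Lr = 1 + 1 / ((p : ℝ) - 1) := by
    rw [hLr]; field_simp; ring
  have hD0 : 0 < D := by
    have : 0 < 1 / ((p : ℝ) - 1) := by positivity
    rw [hD, hLr1]; linarith
  have hexp : q ^ (e₀ / p) * q ^ (D / p) = q ^ (1 / ((p : ℝ) - 1)) := by
    rw [← Real.rpow_add hq0]
    congr 1
    rw [hD, hLr]; field_simp; ring
  have hDp : D / p ≤ 1 / ((p : ℝ) - 1) := by
    have : D / p = 1 / ((p : ℝ) - 1) - e₀ / p := by rw [hD, hLr]; field_simp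
    rw [this]; linarith [div_nonneg he₀0.le hp0r.le]
  -- renormalise `a`
  have ha0 : a ≠ 0 := ne_zero_of_irreducible_X_pow_sub_C' hprime.one_lt.ne' hirr
  have ha0E : (a : NormedAlgClosure F) ≠ 0 := fun h => ha0 (by exact_mod_cast h)
  obtain ⟨b, hbM, hb0, hb⟩ := exists_mul_pow_norm_sub_one_le M.toSubfield hprime hp0 hq1 hs
    (fun x hx hx0 => hΓ x hx hx0) (fun u hu hu1 => hU u hu hu1) a.2 ha0E hDL
  set b' : M := ⟨b, hbM⟩ with hb'
  set a' : M := a * b' ^ p with ha'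
  have ha'E : (a' : NormedAlgClosure F) = (a : NormedAlgClosure F) * b ^ p := by
    rw [ha']; push_cast; rw [hb']
  have hb'0 : b' ≠ 0 := by
    intro h; apply hb0
    have := congrArg Subtype.val h
    simpa [hb'] using this
  have hirr' : Irreducible (X ^ p - C a') := by
    rw [X_pow_sub_C_irreducible_iff_of_prime hprime] at hirr ⊢
    intro z hz
    apply hirr (z / b')
    rw [div_pow, hz, ha', mul_div_cancel_right₀ _ (pow_ne_zero _ hb'0)]
  have ha'1 : (a' : NormedAlgClosure F) ≠ 1 := by
    intro h
    rw [X_pow_sub_C_irreducible_iff_of_prime hprime] at hirr'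
    exact hirr' 1 (by rw [one_pow]; exact_mod_cast h.symm)
  have hdepth : ‖(a' : NormedAlgClosure F) - 1‖ ≤ q ^ D := by rw [ha'E]; exact hb
  have ha'n : ‖(a' : NormedAlgClosure F)‖ = 1 := by
    have hlt : ‖(a' : NormedAlgClosure F) - 1‖ < 1 := hdepth.trans_lt (Real.rpow_lt_one hq0.le hq1 hD0)
    have : (a' : NormedAlgClosure F) = 1 + ((a' : NormedAlgClosure F) - 1) := by ring
    rw [this]
    have h := IsUltrametricDist.norm_add_eq_max_of_norm_ne_norm (x := (1 : NormedAlgClosure F))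
      (y := (a' : NormedAlgClosure F) - 1) (by rw [norm_one]; exact hlt.ne')
    rw [h, norm_one, max_eq_left hlt.le]
  -- `α' = α b`, `β = α' - 1`
  set α' : NormedAlgClosure F := α * b with hα'
  have hα'p : α' ^ p = (a' : NormedAlgClosure F) := by rw [hα', mul_pow, hα, ha'E]
  have hα'n : ‖α'‖ = 1 := by
    have : ‖α'‖ ^ p = 1 := by rw [← norm_pow, hα'p, ha'n]
    exact (pow_eq_one_iff_of_nonneg (norm_nonneg _) hprime.ne_zero).mp this
  have hα'L : α' ∈ L := mul_mem (mem_adjoin_simple_self _ α) (IntermediateField.algebraMap_mem L b')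
  set β : NormedAlgClosure F := α' - 1 with hβ
  have hβL : β ∈ L := sub_mem hα'L (one_mem _)
  have hβ0 : β ≠ 0 := by
    intro h; apply ha'1
    rw [← hα'p, show α' = 1 from sub_eq_zero.mp h, one_pow]
  have hβ1 : ‖β‖ ≤ 1 := by
    rw [hβ, sub_eq_add_neg]
    refine (IsUltrametricDist.norm_add_le_max _ _).trans ?_
    rw [norm_neg, hα'n, norm_one, max_self]
  -- `‖β‖ ≤ q^{D/p}`
  have hβD : ‖β‖ ≤ q ^ (D / p) := by
    have hβp : ‖β‖ ^ p ≤ max ‖(a' : NormedAlgClosure F) - 1‖ (q * ‖β‖) := by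
      have : β ^ p = (α' ^ p - 1) + (-((1 + β) ^ p - 1 - β ^ p)) := by
        rw [hβ]; ring
      rw [← norm_pow, this, hα'p]
      refine (IsUltrametricDist.norm_add_le_max _ _).trans (max_le_max le_rfl ?_)
      rw [norm_neg]; exact KummerTrace.norm_one_add_pow_sub_le hprime β hβ1
    rcases le_max_iff.mp hβp with h | h
    · have h2 : ‖β‖ ^ p ≤ q ^ D := h.trans hdepth
      calc ‖β‖ = (‖β‖ ^ p) ^ ((p : ℝ)⁻¹) :=
            (Real.pow_rpow_inv_natCast (norm_nonneg _) hprime.ne_zero).symm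
        _ ≤ (q ^ D) ^ ((p : ℝ)⁻¹) :=
            Real.rpow_le_rpow (pow_nonneg (norm_nonneg _) _) h2 (inv_nonneg.mpr hp0r.le)
        _ = q ^ (D / p) := by rw [← Real.rpow_mul hq0.le, div_eq_mul_inv]
    · have hβpos : 0 < ‖β‖ := norm_pos_iff.mpr hβ0
      have h2 : ‖β‖ ^ (p - 1) ≤ q := by
        have : ‖β‖ ^ p = ‖β‖ ^ (p - 1) * ‖β‖ := by
          rw [← pow_succ, Nat.sub_add_cancel hprime.one_le]
        rw [this] at h
        exact le_of_mul_le_mul_right h hβpos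
      have hp1r : (0 : ℝ) < (p : ℝ) - 1 := by linarith
      have hcast : ((p - 1 : ℕ) : ℝ) = (p : ℝ) - 1 := by
        rw [Nat.cast_sub hprime.one_le, Nat.cast_one]
      calc ‖β‖ = (‖β‖ ^ (p - 1)) ^ (((p : ℝ) - 1)⁻¹) := by
            rw [← hcast]
            exact (Real.pow_rpow_inv_natCast (norm_nonneg _) (Nat.sub_ne_zero_of_lt hprime.one_lt)).symm
        _ ≤ q ^ (((p : ℝ) - 1)⁻¹) :=
            Real.rpow_le_rpow (pow_nonneg (norm_nonneg _) _) h2 (inv_nonneg.mpr hp1r.le)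
        _ ≤ q ^ (D / p) := by
            refine Real.rpow_le_rpow_of_exponent_ge hq0 hq1.le ?_
            rw [← one_div]; exact hDp
  -- `c ∈ M` with `‖c‖ = ‖β‖`, `γ = β / c`, `θ = γ^p`
  obtain ⟨c, hcM, hc0, hcβ⟩ := adjoin_exists_norm_eq hp M hΓ hirr hα hβL hβ0
  set γ : NormedAlgClosure F := β / c with hγ
  have hγL : γ ∈ L := div_mem hβL (IntermediateField.algebraMap_mem L ⟨c, hcM⟩)
  have hγn : ‖γ‖ = 1 := by rw [hγ, norm_div, hcβ, div_self (norm_ne_zero_iff.mpr hβ0)]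
  set θ : NormedAlgClosure F := γ ^ p with hθ
  have hθL : θ ∈ L := pow_mem hγL p
  have hα0 : α ≠ 0 := by
    intro h; apply ha0E; rw [← hα, h, zero_pow hprime.ne_zero]
  -- conjugate bound, for `g` fixing `M` with `g • α ≠ α`
  have hconj : ∀ g : BaseGaloisGroup hp, (∀ y ∈ M, g • y = y) → g • α ≠ α →
      q ^ e₀ ≤ ‖θ - g • θ‖ ∧ g • θ ≠ θ := by
    intro g hgM hgα
    have hgα' : g • α' ≠ α' := by
      intro h; apply hgα
      rw [hα', BaseGaloisGroup.smul_def, map_mul, show g b = b from hgM b hbM] at h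
      rw [BaseGaloisGroup.smul_def]
      exact mul_right_cancel₀ hb0 h
    exact norm_sub_smul_twisted_ge hp M a'.2 hcM hα'p hα'n hβ0 hcβ hβD he₀1 hexp g hgM hgα'
  -- there IS `g` fixing `M` with `g • α ≠ α` (`ζ₀ α` is a conjugate of `α`)
  have hminα : minpoly M α = X ^ p - C a :=
    (minpoly.eq_of_irreducible_of_monic hirr (by simp [hα]) (monic_X_pow_sub_C a hprime.ne_zero)).symm
  obtain ⟨g₀, hg₀M, hg₀α⟩ : ∃ g : BaseGaloisGroup hp, (∀ y ∈ M, g • y = y) ∧ g • α ≠ α := by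
    have hζ₀p' : IsPrimitiveRoot (CyclotomicTower.zeta F p 1) (p ^ 1) := CyclotomicTower.zeta_spec F p 1
    have hζ₀p : IsPrimitiveRoot (CyclotomicTower.zeta F p 1) p := by rwa [pow_one] at hζ₀p'
    have hζ₀1 : CyclotomicTower.zeta F p 1 ≠ 1 := hζ₀p.ne_one hprime.one_lt
    have hr : CyclotomicTower.zeta F p 1 * α ∈ (minpoly M α).aroots (NormedAlgClosure F) := by
      rw [mem_aroots, hminα]
      refine ⟨(monic_X_pow_sub_C a hprime.ne_zero).ne_zero, ?_⟩
      simp only [map_sub, map_pow, aeval_X, aeval_C, mul_pow, hζ₀p.pow_eq_one, one_mul, hα,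
        IntermediateField.algebraMap_apply, sub_self]
    obtain ⟨g, hgM, hg⟩ :=
      BaseGaloisGroup.exists_smul_eq_of_mem_aroots_base hp M α (CyclotomicTower.zeta F p 1 * α) hr
    refine ⟨g, hgM, ?_⟩
    rw [← hg]
    intro h
    exact hζ₀1 ((mul_left_eq_self₀.mp h).resolve_right hα0)
  -- `θ ∉ M`, so `θ` generates `L`
  have hθM : θ ∉ Set.range (algebraMap M (NormedAlgClosure F)) := by
    rintro ⟨m, hm⟩
    apply (hconj g₀ hg₀M hg₀α).2
    rw [← hm, IntermediateField.algebraMap_apply]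
    exact hg₀M _ m.2
  set θL : L := ⟨θ, hθL⟩ with hθLdef
  have hθLint : IsIntegral M θL := .of_finite M θL
  have htop : (↥M)⟮θL⟯ = ⊤ := adjoin_eq_top_of_not_mem hp M hfin θL hθM
  set pbθ : PowerBasis M L := (adjoin.powerBasis hθLint).map
    ((IntermediateField.equivOfEq htop).trans IntermediateField.topEquiv) with hpbθ
  have hpbgen : pbθ.gen = θL := by
    simp [hpbθ]
  have hgenE : ((pbθ.gen : L) : NormedAlgClosure F) = γ ^ p := by rw [hpbgen]
  -- lower bound for `‖f'(θ)‖`, `f = minpoly M θL`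
  have hH : q ^ δ ≤ ‖((aeval pbθ.gen (derivative (minpoly M pbθ.gen)) : L) : NormedAlgClosure F)‖ := by
    classical
    rw [hpbgen]
    set P' : (NormedAlgClosure F)[X] := (minpoly M θL).map (algebraMap M (NormedAlgClosure F)) with hP'
    have hsp : P'.Splits := IsAlgClosed.splits P'
    have hmo : P'.Monic := (minpoly.monic hθLint).map _
    have hminθ : minpoly M (θ : NormedAlgClosure F) = minpoly M θL :=
      minpoly.algHom_eq L.val Subtype.val_injective θL
    have hθroot : θ ∈ P'.roots := by
      rw [mem_roots hmo.ne_zero, IsRoot, hP', eval_map_algebraMap, ← hminθ, minpoly.aeval]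
    have hcoe : ((aeval θL (derivative (minpoly M θL)) : L) : NormedAlgClosure F) =
        eval θ P'.derivative := by
      rw [← IntermediateField.aeval_coe L θL, hP', derivative_map, eval_map_algebraMap]
    rw [hcoe, hsp.eval_root_derivative hmo hθroot]
    have hsep : P'.Separable := by
      rw [hP']; exact (minpoly.irreducible hθLint).separable.map
    have hnodup : P'.roots.Nodup := nodup_roots hsep
    have hfac : ∀ y ∈ (P'.roots.erase θ).map (θ - ·), q ^ e₀ ≤ ‖y‖ := by
      intro y hy
      obtain ⟨r, hr, rfl⟩ := Multiset.mem_map.mp hy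
      obtain ⟨hrθ, hr'⟩ := (hnodup.mem_erase_iff).mp hr
      have hr'' : r ∈ (minpoly M (θ : NormedAlgClosure F)).aroots (NormedAlgClosure F) := by
        rw [hminθ]; exact hr'
      obtain ⟨g, hgM, hg⟩ := BaseGaloisGroup.exists_smul_eq_of_mem_aroots_base hp M θ r hr''
      have hgα : g • α ≠ α := by
        intro h
        apply hrθ
        rw [BaseGaloisGroup.smul_def] at h
        rw [hg, hθ, hγ, hβ, hα', BaseGaloisGroup.smul_def, map_pow, map_div₀, map_sub, map_mul, h,
          map_one, show g b = b from hgM b hbM, show g c = c from hgM c hcM]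
      rw [hg]
      exact (hconj g hgM hgα).1
    have hnat : P'.natDegree ≤ p := by
      rw [hP', (minpoly.monic hθLint).natDegree_map]
      exact (minpoly.natDegree_le θL).trans_eq hfin
    have hcard : Multiset.card ((P'.roots.erase θ).map (θ - ·)) ≤ p - 1 := by
      rw [Multiset.card_map, Multiset.card_erase_of_mem hθroot, Nat.pred_eq_sub_one]
      have h1 : Multiset.card P'.roots ≤ P'.natDegree := card_roots' P'
      omega
    calc q ^ δ = (q ^ e₀) ^ (p - 1) := by
          rw [← Real.rpow_natCast, ← Real.rpow_mul hq0.le, Nat.cast_sub hprime.one_le, Nat.cast_one, he₀,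
            div_mul_cancel₀ _ hp1ne]
      _ ≤ (q ^ e₀) ^ Multiset.card ((P'.roots.erase θ).map (θ - ·)) :=
          pow_le_pow_of_le_one (Real.rpow_nonneg hq0.le _) (Real.rpow_le_one hq0.le hq1.le he₀0.le) hcard
      _ ≤ ‖((P'.roots.erase θ).map (θ - ·)).prod‖ :=
          pow_card_le_norm_multiset_prod _ (Real.rpow_nonneg hq0.le _) hfac
  -- conclude with the twisted power basis
  have hmain := exists_norm_sub_pow_le_of_twisted_powerBasis hp M L pbθ hγL hγn hgenE hs hδ0.le hΓ hU
    hH hu hu1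
  have hexp' : min s 1 - δ = s' := by rw [hδ]; ring
  rwa [hexp'] at hmain

end KummerStep

end TateAlmostEtale

end Literature.NumberTheory.PAdicHodge

end
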